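import Summits.QuantumAdvantage.QuantumAdvantage.Theorems.CubicForrelationNearExactIsExactCubicFormCellL2
import Summits.QuantumAdvantage.QuantumAdvantage.Theorems.CubicForrelationNearExactIsExactCubicFormBalanced
import Summits.QuantumAdvantage.QuantumAdvantage.Theorems.CubicForrelationNearExactIsExactCubicFormR4TCells

/-!
# Crux `CubicForrelation.NearExactIsExact` (stmt-QuantumAdvantage-14043) — E1280-even, R4 branch, descendant `0` (`HZ`): AFFINE maps on
  `𝔽₂⁴`, induction over unit translations, transversals of a `2`-dimensional subspace, and rows of combined forms

Certificate seat `b2b-cforr-cert` (gen 43).  HONEST FRAMING: kernel-checked elementary lemmas (standard axioms) for the descendant `t̄₇ = 0`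
(R4-PARTNER §4: the forms `β_v` of the cells are affine in the cell index `v ∈ 𝔽₂⁴` and vanish on the zero cells; three zero cells span a
`2`-flat `A = z₁ + D` and `β` is constant on the cosets of `D`).
* `tq0_af_two`, `tq0_af_three`: an affine function `g = e ⊕ Σ vₜeₜ` satisfies `g(a ⊕ b ⊕ c) = g(a) ⊕ g(b) ⊕ g(c)`.
* `tq0_units_induction`: a predicate holding at `0` and stable under all unit translations holds everywhere.
* `tq0_transversal` (`decide`): for a `2`-dimensional `D = ⟨δ₁, δ₂⟩ ≤ 𝔽₂⁴` there are unit vectors `e_i, e_j` spanning a complement, and every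
  unit vector `e_m` is `x_i e_i ⊕ x_j e_j` modulo `D` for explicit bits.
* `tq0_row_comb`: for quadratics `g, h₁, h₂` on `𝔽₂ⁿ`, a relation `B_g = a·B_{h₁} ⊕ b·B_{h₂}` between the forms on unit vectors extends to
  all rows `B(u, e_k)`.
Nothing about `θ₁₂`; NOT summit progress.

References: this seat lineage (g37 R4-PARTNER §4, g43 LEAN-GEN43).  Axioms: the standard three.
-/

set_option linter.dupNamespace false -- D-0017: single-problem summit ⇒ `QuantumAdvantage.QuantumAdvantage` by design
set_option synthInstance.maxSize 8192
set_option synthInstance.maxHeartbeats 200000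

namespace Summit.QuantumAdvantage.QuantumAdvantage.Theorems.CubicForrelation.NearExactIsExact

open Finset
open Literature.Computability.QuantumComplexity
open Literature.Computability.QuantumComplexity.BuzetChailloux (bxor zeroVec bxor_comm bxor_self bxor_zeroVec zeroVec_bxor
  bxor_bxor_cancel_left)

/-- Core of `tq0_af_two`: componentwise. [folklore] -/
theorem tq0_af_two_core : ∀ (e e0 e1 e2 e3 a0 a1 a2 a3 b0 b1 b2 b3 : Bool),
    ((((e ^^ ((a0 ^^ b0) && e0)) ^^ ((a1 ^^ b1) && e1)) ^^ ((a2 ^^ b2) && e2)) ^^ ((a3 ^^ b3) && e3)) =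
      ((((((e ^^ (a0 && e0)) ^^ (a1 && e1)) ^^ (a2 && e2)) ^^ (a3 && e3)) ^^ ((((e ^^ (b0 && e0)) ^^ (b1 && e1)) ^^ (b2 && e2)) ^^ (b3 && e3))) ^^ e) := by
  decide

/-- **Affine functions on two points**: `g(a ⊕ b) = g(a) ⊕ g(b) ⊕ g(0)`-type identity `g(a ⊕ b) = g(a) ⊕ g(b) ⊕ e`. [folklore] -/
theorem tq0_af_two (e e0 e1 e2 e3 : Bool) (a b : Fin 4 → Bool) :
    ((((e ^^ ((bxor a b) 0 && e0)) ^^ ((bxor a b) 1 && e1)) ^^ ((bxor a b) 2 && e2)) ^^ ((bxor a b) 3 && e3)) = ((((((e ^^ (a 0 && e0)) ^^ (a 1 && e1)) ^^ (a 2 && e2)) ^^ (a 3 && e3)) ^^ ((((e ^^ (b 0 && e0)) ^^ (b 1 && e1)) ^^ (b 2 && e2)) ^^ (b 3 && e3))) ^^ e) :=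
  tq0_af_two_core e e0 e1 e2 e3 (a 0) (a 1) (a 2) (a 3) (b 0) (b 1) (b 2) (b 3)

/-- **Affine functions on three points**: `g(a ⊕ b ⊕ c) = g(a) ⊕ g(b) ⊕ g(c)`. [folklore] -/
theorem tq0_af_three (e e0 e1 e2 e3 : Bool) (a b c : Fin 4 → Bool) :
    ((((e ^^ ((bxor (bxor a b) c) 0 && e0)) ^^ ((bxor (bxor a b) c) 1 && e1)) ^^ ((bxor (bxor a b) c) 2 && e2)) ^^ ((bxor (bxor a b) c) 3 && e3)) = ((((((e ^^ (a 0 && e0)) ^^ (a 1 && e1)) ^^ (a 2 && e2)) ^^ (a 3 && e3)) ^^ ((((e ^^ (b 0 && e0)) ^^ (b 1 && e1)) ^^ (b 2 && e2)) ^^ (b 3 && e3))) ^^ ((((e ^^ (c 0 && e0)) ^^ (c 1 && e1)) ^^ (c 2 && e2)) ^^ (c 3 && e3))) := by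
  rw [tq0_af_two e e0 e1 e2 e3 (bxor a b) c, tq0_af_two e e0 e1 e2 e3 a b]
  generalize ((((e ^^ (a 0 && e0)) ^^ (a 1 && e1)) ^^ (a 2 && e2)) ^^ (a 3 && e3)) = x
  generalize ((((e ^^ (b 0 && e0)) ^^ (b 1 && e1)) ^^ (b 2 && e2)) ^^ (b 3 && e3)) = y
  generalize ((((e ^^ (c 0 && e0)) ^^ (c 1 && e1)) ^^ (c 2 && e2)) ^^ (c 3 && e3)) = z
  revert x y z e; decide

/-- **Induction over unit translations**: a predicate true at `0` and preserved by every unit translation holds everywhere. [folklore] -/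
theorem tq0_units_induction {n : ℕ} (P : (Fin n → Bool) → Prop) (h0 : P zeroVec)
    (hstep : ∀ (x : Fin n → Bool) (j : Fin n), P x → P (bxor x (fun l => decide (l = j)))) : ∀ x, P x := by
  suffices H : ∀ (k : ℕ) (x : Fin n → Bool), #(univ.filter fun j => x j = true) ≤ k → P x from fun x => H _ x le_rfl
  intro k
  induction k with
  | zero =>
    intro x hx
    have hx0 : x = zeroVec := by
      funext j
      have hj : j ∉ (univ.filter fun j => x j = true) := by
        rw [Nat.le_zero, card_eq_zero] at hx
        rw [hx]; exact notMem_empty j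
      cases e : x j
      · rfl
      · exact (hj (mem_filter.mpr ⟨mem_univ j, e⟩)).elim
    rw [hx0]; exact h0
  | succ k ih =>
    intro x hx
    by_cases hx0 : ∃ j, x j = true
    · obtain ⟨j, hj⟩ := hx0
      have ex : x = bxor (bxor x (fun l => decide (l = j))) (fun l => decide (l = j)) := by
        funext l; simp [bxor]
      rw [ex]
      apply hstep
      apply ih
      have hsub : (univ.filter fun l => bxor x (fun l => decide (l = j)) l = true) = (univ.filter fun l => x l = true).erase j := by
        ext l
        simp only [mem_filter, mem_univ, true_and, mem_erase, bxor]
        by_cases hl : l = j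
        · subst hl; simp [hj]
        · simp [hl]
      have hmem : j ∈ (univ.filter fun l => x l = true) := mem_filter.mpr ⟨mem_univ j, hj⟩
      rw [hsub, card_erase_of_mem hmem]
      omega
    · push Not at hx0
      have : x = zeroVec := by funext j; show x j = false; simpa using hx0 j
      rw [this]; exact h0

/-- **Transversal unit vectors for a plane** (`decide`): for a `2`-dimensional `D = ⟨δ₁, δ₂⟩ ≤ 𝔽₂⁴` (`δ₁, δ₂ ≠ 0`, `δ₁ ≠ δ₂`) there are
unit vectors `e_i, e_j` with `e_i, e_j, e_i ⊕ e_j ∉ D`, and every unit vector `e_m` satisfies `e_m ⊕ x_i e_i ⊕ x_j e_j ∈ D` for some bits;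
membership in `D = {0, δ₁, δ₂, δ₁ ⊕ δ₂}` is spelled out componentwise. [folklore] -/
theorem tq0_transversal : ∀ (d10 d11 d12 d13 d20 d21 d22 d23 : Bool),
    (d10 || d11 || d12 || d13) = true → (d20 || d21 || d22 || d23) = true →
    ((d10 ^^ d20) || (d11 ^^ d21) || (d12 ^^ d22) || (d13 ^^ d23)) = true →
    ∃ i j : Fin 4, i ≠ j ∧
      ((!decide ((0 : Fin 4) = i) && !decide ((1 : Fin 4) = i) && !decide ((2 : Fin 4) = i) && !decide ((3 : Fin 4) = i)) || ((decide ((0 : Fin 4) = i) == d10) && (decide ((1 : Fin 4) = i) == d11) && (decide ((2 : Fin 4) = i) == d12) && (decide ((3 : Fin 4) = i) == d13)) || ((decide ((0 : Fin 4) = i) == d20) && (decide ((1 : Fin 4) = i) == d21) && (decide ((2 : Fin 4) = i) == d22) && (decide ((3 : Fin 4) = i) == d23)) || ((decide ((0 : Fin 4) = i) == (d10 ^^ d20)) && (decide ((1 : Fin 4) = i) == (d11 ^^ d21)) && (decide ((2 : Fin 4) = i) == (d12 ^^ d22)) && (decide ((3 : Fin 4) = i) == (d13 ^^ d23)))) =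 false ∧
      ((!decide ((0 : Fin 4) = j) && !decide ((1 : Fin 4) = j) && !decide ((2 : Fin 4) = j) && !decide ((3 : Fin 4) = j)) || ((decide ((0 : Fin 4) = j) == d10) && (decide ((1 : Fin 4) = j) == d11) && (decide ((2 : Fin 4) = j) == d12) && (decide ((3 : Fin 4) = j) == d13)) || ((decide ((0 : Fin 4) = j) == d20) && (decide ((1 : Fin 4) = j) == d21) && (decide ((2 : Fin 4) = j) == d22) && (decide ((3 : Fin 4) = j) == d23)) || ((decide ((0 : Fin 4) = j) == (d10 ^^ d20)) && (decide ((1 : Fin 4) = j) == (d11 ^^ d21)) && (decide ((2 : Fin 4) = j) == (d12 ^^ d22)) && (decide ((3 : Fin 4) = j) == (d13 ^^ d23)))) = false ∧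
      ((!(decide ((0 : Fin 4) = i) ^^ decide ((0 : Fin 4) = j)) && !(decide ((1 : Fin 4) = i) ^^ decide ((1 : Fin 4) = j)) && !(decide ((2 : Fin 4) = i) ^^ decide ((2 : Fin 4) = j)) && !(decide ((3 : Fin 4) = i) ^^ decide ((3 : Fin 4) = j))) || (((decide ((0 : Fin 4) = i) ^^ decide ((0 : Fin 4) = j)) == d10) && ((decide ((1 : Fin 4) = i) ^^ decide ((1 : Fin 4) = j)) == d11) && ((decide ((2 : Fin 4) = i) ^^ decide ((2 : Fin 4) = j)) == d12) && ((decide ((3 : Fin 4) = i) ^^ decide ((3 : Fin 4) = j)) == d13)) || (((decide ((0 : Fin 4) = i) ^^ decide ((0 : Fin 4) = j)) == d20) && ((decide ((1 : Fin 4) = i) ^^ decide ((1 : Fin 4) = j)) == d21) && ((decide ((2 : Fin 4) = i) ^^ decide ((2 : Fin 4) = j)) == d22) && ((decide ((3 : Fin 4) = i) ^^ decide ((3 : Fin 4) = j)) == d23)) || (((decide ((0 : Fin 4) = i) ^^ decide ((0 : Fin 4) = j)) == (d10 ^^ d20)) && ((decide ((1 : Fin 4) = i) ^^ decide ((1 :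 Fin 4) = j)) == (d11 ^^ d21)) && ((decide ((2 : Fin 4) = i) ^^ decide ((2 : Fin 4) = j)) == (d12 ^^ d22)) && ((decide ((3 : Fin 4) = i) ^^ decide ((3 : Fin 4) = j)) == (d13 ^^ d23)))) = false ∧
      ∀ m : Fin 4, ∃ xi xj : Bool,
        ((!((decide ((0 : Fin 4) = m) ^^ (xi && decide ((0 : Fin 4) = i))) ^^ (xj && decide ((0 : Fin 4) = j))) && !((decide ((1 : Fin 4) = m) ^^ (xi && decide ((1 : Fin 4) = i))) ^^ (xj && decide ((1 : Fin 4) = j))) && !((decide ((2 : Fin 4) = m) ^^ (xi && decide ((2 : Fin 4) = i))) ^^ (xj && decide ((2 : Fin 4) = j))) && !((decide ((3 : Fin 4) = m) ^^ (xi && decide ((3 : Fin 4) = i))) ^^ (xj && decide ((3 : Fin 4) = j)))) || ((((decide ((0 : Fin 4) = m) ^^ (xi && decide ((0 : Fin 4) = i))) ^^ (xj && decide ((0 : Fin 4) = j))) == d10) && (((decide ((1 : Fin 4) = m) ^^ (xi && decide ((1 : Fin 4) = i))) ^^ (xj && decide ((1 : Fin 4) = j))) == d11) && (((decide ((2 :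 Fin 4) = m) ^^ (xi && decide ((2 : Fin 4) = i))) ^^ (xj && decide ((2 : Fin 4) = j))) == d12) && (((decide ((3 : Fin 4) = m) ^^ (xi && decide ((3 : Fin 4) = i))) ^^ (xj && decide ((3 : Fin 4) = j))) == d13)) || ((((decide ((0 : Fin 4) = m) ^^ (xi && decide ((0 : Fin 4) = i))) ^^ (xj && decide ((0 : Fin 4) = j))) == d20) && (((decide ((1 : Fin 4) = m) ^^ (xi && decide ((1 : Fin 4) = i))) ^^ (xj && decide ((1 : Fin 4) = j))) == d21) && (((decide ((2 : Fin 4) = m) ^^ (xi && decide ((2 : Fin 4) = i))) ^^ (xj && decide ((2 : Fin 4) = j))) == d22) && (((decide ((3 : Fin 4) = m) ^^ (xi && decide ((3 : Fin 4) = i))) ^^ (xj && decide ((3 : Fin 4) = j))) == d23)) || ((((decide ((0 : Fin 4) = m) ^^ (xi && decide ((0 : Fin 4) = i))) ^^ (xj && decide ((0 : Fin 4) = j))) == (d10 ^^ d20)) && (((decide ((1 : Fin 4) = m) ^^ (xi && decide ((1 : Fin 4) = i))) ^^ (xj && decide ((1 : Fin 4) = j))) == (d11 ^^ d21)) && (((decide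 ((2 : Fin 4) = m) ^^ (xi && decide ((2 : Fin 4) = i))) ^^ (xj && decide ((2 : Fin 4) = j))) == (d12 ^^ d22)) && (((decide ((3 : Fin 4) = m) ^^ (xi && decide ((3 : Fin 4) = i))) ^^ (xj && decide ((3 : Fin 4) = j))) == (d13 ^^ d23)))) = true := by
  decide

section RowComb

variable {n : ℕ} (g h₁ h₂ : (Fin n → Bool) → Bool)
  (hg : ∀ u v w x : Fin n → Bool, (((g x ^^ g (bxor x w)) ^^ (g (bxor x v) ^^ g (bxor (bxor x v) w))) ^^
      ((g (bxor x u) ^^ g (bxor (bxor x u) w)) ^^ (g (bxor (bxor x u) v) ^^ g (bxor (bxor (bxor x u) v) w)))) = false)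
  (hh₁ : ∀ u v w x : Fin n → Bool, (((h₁ x ^^ h₁ (bxor x w)) ^^ (h₁ (bxor x v) ^^ h₁ (bxor (bxor x v) w))) ^^
      ((h₁ (bxor x u) ^^ h₁ (bxor (bxor x u) w)) ^^ (h₁ (bxor (bxor x u) v) ^^ h₁ (bxor (bxor (bxor x u) v) w)))) = false)
  (hh₂ : ∀ u v w x : Fin n → Bool, (((h₂ x ^^ h₂ (bxor x w)) ^^ (h₂ (bxor x v) ^^ h₂ (bxor (bxor x v) w))) ^^
      ((h₂ (bxor x u) ^^ h₂ (bxor (bxor x u) w)) ^^ (h₂ (bxor (bxor x u) v) ^^ h₂ (bxor (bxor (bxor x u) v) w)))) = false)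
include hg hh₁ hh₂

/-- **Rows of combined forms.**  For quadratics `g, h₁, h₂`: if on unit vectors `Δ_{e_j,e_k} g(0) = a·Δ_{e_j,e_k} h₁(0) ⊕ b·Δ_{e_j,e_k} h₂(0)`,
then `Δ_{u,e_k} g(0) = a·Δ_{u,e_k} h₁(0) ⊕ b·Δ_{u,e_k} h₂(0)` for every vector `u`. [this work] -/
theorem tq0_row_comb (a b : Bool)
    (hunit : ∀ j k : Fin n, ((g zeroVec ^^ g (fun l => decide (l = k))) ^^ (g (fun l => decide (l = j)) ^^ g (bxor (fun l => decide (l = j)) (fun l => decide (l = k))))) =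
      ((a && ((h₁ zeroVec ^^ h₁ (fun l => decide (l = k))) ^^ (h₁ (fun l => decide (l = j)) ^^ h₁ (bxor (fun l => decide (l = j)) (fun l => decide (l = k)))))) ^^
       (b && ((h₂ zeroVec ^^ h₂ (fun l => decide (l = k))) ^^ (h₂ (fun l => decide (l = j)) ^^ h₂ (bxor (fun l => decide (l = j)) (fun l => decide (l = k))))))))
    (u : Fin n → Bool) (k : Fin n) :
    ((g zeroVec ^^ g (fun l => decide (l = k))) ^^ (g u ^^ g (bxor u (fun l => decide (l = k))))) =
      ((a && ((h₁ zeroVec ^^ h₁ (fun l => decide (l = k))) ^^ (h₁ u ^^ h₁ (bxor u (fun l => decide (l = k)))))) ^^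
       (b && ((h₂ zeroVec ^^ h₂ (fun l => decide (l = k))) ^^ (h₂ u ^^ h₂ (bxor u (fun l => decide (l = k))))))) := by
  -- the three forms (first-slot additive)
  obtain ⟨-, hag, -, -⟩ := tcb_form_basic g _ (fun v w x => tl2_second_const g hg v w x)
  obtain ⟨-, ha1, -, -⟩ := tcb_form_basic h₁ _ (fun v w x => tl2_second_const h₁ hh₁ v w x)
  obtain ⟨-, ha2, -, -⟩ := tcb_form_basic h₂ _ (fun v w x => tl2_second_const h₂ hh₂ v w x)
  -- the difference `u ↦ LHS ⊕ RHS` is invariant under unit translations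
  have key := tq1_const_of_units (fun u =>
      (((g zeroVec ^^ g (bxor zeroVec (fun l => decide (l = k)))) ^^ (g (bxor zeroVec u) ^^ g (bxor (bxor zeroVec u) (fun l => decide (l = k))))) ^^
        ((a && ((h₁ zeroVec ^^ h₁ (bxor zeroVec (fun l => decide (l = k)))) ^^ (h₁ (bxor zeroVec u) ^^ h₁ (bxor (bxor zeroVec u) (fun l => decide (l = k)))))) ^^
         (b && ((h₂ zeroVec ^^ h₂ (bxor zeroVec (fun l => decide (l = k)))) ^^ (h₂ (bxor zeroVec u) ^^ h₂ (bxor (bxor zeroVec u) (fun l => decide (l = k)))))))))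
    (fun x j => by
      show (((g zeroVec ^^ g (bxor zeroVec (fun l => decide (l = k)))) ^^ (g (bxor zeroVec (bxor x (fun l => decide (l = j)))) ^^ g (bxor (bxor zeroVec (bxor x (fun l => decide (l = j)))) (fun l => decide (l = k))))) ^^
          ((a && ((h₁ zeroVec ^^ h₁ (bxor zeroVec (fun l => decide (l = k)))) ^^ (h₁ (bxor zeroVec (bxor x (fun l => decide (l = j)))) ^^ h₁ (bxor (bxor zeroVec (bxor x (fun l => decide (l = j)))) (fun l => decide (l = k)))))) ^^
           (b && ((h₂ zeroVec ^^ h₂ (bxor zeroVec (fun l => decide (l = k)))) ^^ (h₂ (bxor zeroVec (bxor x (fun l => decide (l = j)))) ^^ h₂ (bxor (bxor zeroVec (bxor x (fun l => decide (l = j)))) (fun l => decide (l = k)))))))) =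
        (((g zeroVec ^^ g (bxor zeroVec (fun l => decide (l = k)))) ^^ (g (bxor zeroVec x) ^^ g (bxor (bxor zeroVec x) (fun l => decide (l = k))))) ^^
          ((a && ((h₁ zeroVec ^^ h₁ (bxor zeroVec (fun l => decide (l = k)))) ^^ (h₁ (bxor zeroVec x) ^^ h₁ (bxor (bxor zeroVec x) (fun l => decide (l = k)))))) ^^
           (b && ((h₂ zeroVec ^^ h₂ (bxor zeroVec (fun l => decide (l = k)))) ^^ (h₂ (bxor zeroVec x) ^^ h₂ (bxor (bxor zeroVec x) (fun l => decide (l = k))))))))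
      rw [hag x (fun l => decide (l = j)) (fun l => decide (l = k)), ha1 x (fun l => decide (l = j)) (fun l => decide (l = k)),
        ha2 x (fun l => decide (l = j)) (fun l => decide (l = k))]
      have e := hunit j k
      simp only [zeroVec_bxor] at e ⊢
      rw [e]
      generalize ((g zeroVec ^^ g fun l => decide (l = k)) ^^ (g x ^^ g (bxor x fun l => decide (l = k)))) = G
      generalize ((h₁ zeroVec ^^ h₁ fun l => decide (l = k)) ^^ (h₁ x ^^ h₁ (bxor x fun l => decide (l = k)))) = H1
      generalize ((h₂ zeroVec ^^ h₂ fun l => decide (l = k)) ^^ (h₂ x ^^ h₂ (bxor x fun l => decide (l = k)))) = H2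
      generalize ((h₁ zeroVec ^^ h₁ fun l => decide (l = k)) ^^ ((h₁ fun l => decide (l = j)) ^^ h₁ (bxor (fun l => decide (l = j)) fun l => decide (l = k)))) = U1
      generalize ((h₂ zeroVec ^^ h₂ fun l => decide (l = k)) ^^ ((h₂ fun l => decide (l = j)) ^^ h₂ (bxor (fun l => decide (l = j)) fun l => decide (l = k)))) = U2
      revert G H1 H2 U1 U2; cases a <;> cases b <;> decide)
  have e := key u
  simp only [zeroVec_bxor, Bool.xor_self, Bool.and_false] at e
  revert e
  generalize ((g zeroVec ^^ g fun l => decide (l = k)) ^^ (g u ^^ g (bxor u fun l => decide (l = k)))) = G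
  generalize ((h₁ zeroVec ^^ h₁ fun l => decide (l = k)) ^^ (h₁ u ^^ h₁ (bxor u fun l => decide (l = k)))) = H1
  generalize ((h₂ zeroVec ^^ h₂ fun l => decide (l = k)) ^^ (h₂ u ^^ h₂ (bxor u fun l => decide (l = k)))) = H2
  revert G H1 H2; cases a <;> cases b <;> decide

end RowComb

end Summit.QuantumAdvantage.QuantumAdvantage.Theorems.CubicForrelation.NearExactIsExact
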